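import Summits.ABC.StewartYu.RecordExitBGeneric
import HarnessLib

/-!
# Exit B of the Gen-3 record on the CAPPED letters (archimedean one-stage record `ArchG3Rec`, plan R41)

`Summits/ABC/StewartYu/RecordExitsCapped.lean` — cell `abc-stewartyu`, route `YuMatveevShapeRat`, crux r2 `ArchCoreRat`
(stmt-ABC-20502); seat p1 (record owner). Theorems only; no named facts.

The p-adic generic exit-B lemma `RecordExitsNumeric.exitB_of` plays `D₀` and `L` against the FINAL RANGE through
`(3/2)(n+1)L ≤ X·cΩK`, `D₀ ≤ 8X·cΩK`, `2^{n+22}K < T`, `T·X < 2X_f + 1` (the doubling schedule's `K`-inflated range). On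
print's CAPPED schedule (`ArchG3Rec`: `Xs Ŝ·(T Ŝ+1) ≍ 4XL`, `X_fin ≥ 2^{2n+22}X/(n+1)`) those hypotheses fail; instead
`D₀ ≤ X·L/2` is paired with ONE factor `S₀ + 1 ≥ 16(n+1)L/(n+2)⁴`, the range only needs **`2^{n+23}·X < 2X_f + 1`**, and in
the all-light case (`Vⱼ ≤ ρ` for every `j`, where `Ω·∏Dⱼ ≤ (L/2^{n+22})ⁿ` leaves one `L/Ω`) the box scale is charged to the
weights by **`L ≤ c_L·Ω`** under two NUMERIC side conditions on `c_L` (`hN0`, `hN1`, discharged per record):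
* `exitB_one_capped` (`d₀ = 1`): `(n+1)!·(n−1)!·2ⁿ·∏Dⱼ < (S₀+1)^{n−1}·(2X_f+1)`;
* `exitB_zero_capped` (`d₀ = 0`): `(n+1)!·n!·2ⁿ·D₀·∏Dⱼ < (S₀+1)ⁿ·(2X_f+1)`;
* `exitB_capped`: hypothesis `hB` of `RecordAssembly.recordOdd_of_ineqs`-shape (via `RecordExitsNumeric.exitB_of_bounds`).
The heavy case (`ρ < V_{j*}` for some `j*`) reuses `prod_D_le_of_lt_of` and the master numerics `numB1i`/`numB0i` verbatim.

## References
* [Nesterenko2003] Yu. V. Nesterenko, LNM 1819 (2003) — §5.2 Lemma 5.4, (5.17)–(5.18), with (4.3)/(5.12) (capped ranges).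
-/

noncomputable section

open Finset Real Nat

namespace Summit.ABC.StewartYu

namespace RecordExitsNumeric

open PadicG3Par (numB1i numB0i)

/-- **Exit B, `d₀ = 1`, capped letters**: `(n+1)!·(n−1)!·2ⁿ·∏ Dⱼ < (S₀+1)^{n−1}·(2X_f+1)` from `Dⱼ ≤ ρ/Vⱼ + 1`,
`1 ≤ ρ < L/2^{n+23}`, `16(n+1)L ≤ (S₀+1)(n+2)⁴`, `2^{n+23}X < 2X_f+1`, `1 ≤ X`, `L ≤ c_L·Ω` and the numeric side condition
`hN1 : (n+1)!(n−1)!2ⁿ(n+2)^{4(n−1)}·c_L ≤ (16(n+1))^{n−1}·2^{(n+22)(n−1)}·2^{n+22}·2^{n+23}`. [cite: Nesterenko2003, §5.2 Lemma 5.4] -/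
theorem exitB_one_capped {n : ℕ} (hn : 1 ≤ n) {V : Fin n → ℝ} (hV1 : ∀ j, 1 ≤ V j)
    {D : Fin n → ℕ} {ρ L X cL : ℝ} {S₀ Xf : ℕ}
    (hDρ : ∀ j, (D j : ℝ) ≤ ρ / V j + 1) (hρ1 : 1 ≤ ρ) (hρ : ρ < L / 2 ^ (n + 23)) (hL : 0 < L)
    (hX1 : 1 ≤ X) (hs : (16 : ℝ) * (n + 1) * L ≤ ((S₀ : ℝ) + 1) * ((n : ℝ) + 2) ^ 4)
    (hxf : (2 : ℝ) ^ (n + 23) * X < 2 * (Xf : ℝ) + 1) (hΩL : L ≤ cL * ∏ j, V j)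
    (hN1 : (((n + 1)! : ℕ) : ℝ) * (((n - 1)! : ℕ) : ℝ) * 2 ^ n * ((n : ℝ) + 2) ^ (4 * (n - 1)) * cL ≤
      (16 * ((n : ℝ) + 1)) ^ (n - 1) * 2 ^ ((n + 22) * (n - 1)) * 2 ^ (n + 22) * 2 ^ (n + 23)) :
    (n + 1)! * (n - 1)! * 2 ^ n * ∏ j, D j < (S₀ + 1) ^ (n - 1) * (2 * Xf + 1) := by
  obtain ⟨k, hk⟩ : ∃ k, n = k + 1 := ⟨n - 1, (Nat.sub_add_cancel hn).symm⟩
  subst hk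
  simp only [Nat.add_sub_cancel] at hN1 ⊢
  have hs0 : (0 : ℝ) < (S₀ : ℝ) + 1 := by positivity
  set s : ℝ := (S₀ : ℝ) + 1 with hsdef
  set xf : ℝ := 2 * (Xf : ℝ) + 1 with hxfdef
  have hs' : 16 * ((k : ℝ) + 2) * L ≤ s * ((k : ℝ) + 3) ^ 4 := by
    have := hs; push_cast at this; rw [hsdef]; nlinarith
  have hbase : 0 ≤ 16 * ((k : ℝ) + 2) * L := by positivity
  -- the range: `2^{k+24} ≤ 2^{k+24}·X < xf`
  have hxf' : (2 : ℝ) ^ (k + 24) * X < xf := by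
    simpa [show k + 1 + 23 = k + 24 by ring] using hxf
  have h24 : (2 : ℝ) ^ (k + 24) ≤ 2 ^ (k + 24) * X := le_mul_of_one_le_right (by positivity) hX1
  suffices hreal : (((k + 1 + 1)! : ℕ) : ℝ) * ((k ! : ℕ) : ℝ) * 2 ^ (k + 1) * ∏ j, (D j : ℝ) < s ^ k * xf by
    rw [hsdef, hxfdef] at hreal
    exact_mod_cast hreal
  obtain ⟨j₀, -, hj₀⟩ := Finset.exists_max_image (univ : Finset (Fin (k + 1))) V ⟨0, mem_univ _⟩
  have hprod0 : 0 ≤ ∏ j, (D j : ℝ) := prod_nonneg fun j _ => by positivity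
  have hsk : 0 < s ^ k := by positivity
  by_cases hlt : ρ < V j₀
  · -- heavy case: `∏ D ≤ (L/2^{k+22})^k` (verbatim the generic argument, master numeric `numB1i`)
    have hprod := prod_D_le_of_lt_of hV1 hDρ hρ1 hρ hL hlt
    simp only [Nat.add_sub_cancel] at hprod
    have hnum : (((k + 2)! * k ! * 2 ^ (k + 1) * (k + 3) ^ (4 * k) : ℕ) : ℝ) ≤
        (((16 * (k + 2)) ^ k * 2 ^ ((k + 22) * k) * 2 ^ (k + 24) : ℕ) : ℝ) := by
      exact_mod_cast numB1i k
    push_cast at hnum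
    set Q : ℝ := (16 * ((k : ℝ) + 2)) ^ k * 2 ^ ((k + 22) * k) with hQ
    have hQ0 : 0 < Q := by positivity
    have e1 : (L / 2 ^ (k + 1 + 21)) ^ k * Q = (16 * ((k : ℝ) + 2) * L) ^ k := by
      rw [hQ, show k + 1 + 21 = k + 22 by ring]
      simp only [mul_pow, div_pow]
      rw [← pow_mul]
      field_simp
    have hpow : (16 * ((k : ℝ) + 2) * L) ^ k ≤ (s * ((k : ℝ) + 3) ^ 4) ^ k :=
      pow_le_pow_left₀ hbase hs' k
    have key : (((k + 1 + 1)! : ℕ) : ℝ) * ((k ! : ℕ) : ℝ) * 2 ^ (k + 1) * (∏ j, (D j : ℝ)) * Q ≤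
        (2 ^ (k + 24) * s ^ k) * Q := by
      calc (((k + 1 + 1)! : ℕ) : ℝ) * ((k ! : ℕ) : ℝ) * 2 ^ (k + 1) * (∏ j, (D j : ℝ)) * Q
          ≤ (((k + 1 + 1)! : ℕ) : ℝ) * ((k ! : ℕ) : ℝ) * 2 ^ (k + 1) * (L / 2 ^ (k + 1 + 21)) ^ k * Q := by
            gcongr
        _ = (((k + 1 + 1)! : ℕ) : ℝ) * ((k ! : ℕ) : ℝ) * 2 ^ (k + 1) * ((L / 2 ^ (k + 1 + 21)) ^ k * Q) := by
            ring
        _ ≤ (((k + 1 + 1)! : ℕ) : ℝ) * ((k ! : ℕ) : ℝ) * 2 ^ (k + 1) * (s * ((k : ℝ) + 3) ^ 4) ^ k := by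
            rw [e1]; gcongr
        _ = ((((k + 2)! : ℕ) : ℝ) * ((k ! : ℕ) : ℝ) * 2 ^ (k + 1) * ((k : ℝ) + 3) ^ (4 * k)) * s ^ k := by
            rw [mul_pow, ← pow_mul, show k + 1 + 1 = k + 2 by ring]; ring
        _ ≤ ((16 * ((k : ℝ) + 2)) ^ k * 2 ^ ((k + 22) * k) * 2 ^ (k + 24)) * s ^ k :=
            mul_le_mul_of_nonneg_right hnum (by positivity)
        _ = (2 ^ (k + 24) * s ^ k) * Q := by rw [hQ]; ring
    have hmain := le_of_mul_le_mul_right key hQ0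
    calc (((k + 1 + 1)! : ℕ) : ℝ) * ((k ! : ℕ) : ℝ) * 2 ^ (k + 1) * ∏ j, (D j : ℝ)
        ≤ 2 ^ (k + 24) * s ^ k := hmain
      _ ≤ 2 ^ (k + 24) * X * s ^ k := mul_le_mul_of_nonneg_right h24 hsk.le
      _ < xf * s ^ k := mul_lt_mul_of_pos_right hxf' hsk
      _ = s ^ k * xf := mul_comm _ _
  · -- light case: `Ω ∏ D ≤ (L/2^{k+23})^{k+1}`; the extra `L` is charged to the weights: `L ≤ c_L·Ω`
    have hle : ∀ j, V j ≤ ρ := fun j => (hj₀ j (mem_univ j)).trans (not_lt.mp hlt)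
    have hprod := prod_mul_prod_D_le_of hV1 hDρ hρ1 hρ hL hle
    have hΩ : 0 < ∏ j, V j := prod_pos fun j _ => by linarith [hV1 j]
    have hneed : (((k + 2)! : ℕ) : ℝ) * ((k ! : ℕ) : ℝ) * 2 ^ (k + 1) * ((k : ℝ) + 3) ^ (4 * k) * cL ≤
        (16 * ((k : ℝ) + 2)) ^ k * 2 ^ ((k + 23) * k) * 2 ^ (k + 23) * 2 ^ (k + 24) := by
      have h := hN1
      simp only [show k + 1 + 1 = k + 2 by ring, show k + 1 + 22 = k + 23 by ring,
        show k + 1 + 23 = k + 24 by ring] at h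
      push_cast at h
      have e3 : ((k : ℝ) + 1 + 2) = (k : ℝ) + 3 := by ring
      have e4 : ((k : ℝ) + 1 + 1) = (k : ℝ) + 2 := by ring
      rw [e3, e4] at h
      exact h
    set Q : ℝ := (16 * ((k : ℝ) + 2)) ^ k * 2 ^ ((k + 23) * k) * 2 ^ (k + 23) with hQ
    have hQ0 : 0 < Q := by positivity
    -- `(L/2^{k+23})^{k+1} · Q = (16(k+2)L)^k · L`
    have e2 : ((2 : ℝ) ^ (k + 23)) ^ (k + 1) = 2 ^ ((k + 23) * k) * 2 ^ (k + 23) := by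
      rw [← pow_mul, ← pow_add]; ring_nf
    have e1 : (L / 2 ^ (k + 1 + 22)) ^ (k + 1) * Q = (16 * ((k : ℝ) + 2) * L) ^ k * L := by
      rw [hQ, show k + 1 + 22 = k + 23 by ring, div_pow, e2, mul_pow, pow_succ]
      field_simp
      rw [mul_pow, mul_pow]; ring
    have hpow : (16 * ((k : ℝ) + 2) * L) ^ k ≤ (s * ((k : ℝ) + 3) ^ 4) ^ k :=
      pow_le_pow_left₀ hbase hs' k
    set A : ℝ := (((k + 1 + 1)! : ℕ) : ℝ) * ((k ! : ℕ) : ℝ) * 2 ^ (k + 1) with hA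
    have hA0 : 0 ≤ A := by positivity
    have hfac2 : (((k + 1 + 1)! : ℕ) : ℝ) = (((k + 2)! : ℕ) : ℝ) := by rw [show k + 1 + 1 = k + 2 by ring]
    have key : A * (∏ j, (D j : ℝ)) * ((∏ j, V j) * Q) ≤ (2 ^ (k + 24) * s ^ k) * ((∏ j, V j) * Q) := by
      calc A * (∏ j, (D j : ℝ)) * ((∏ j, V j) * Q)
          = A * ((∏ j, V j) * ∏ j, (D j : ℝ)) * Q := by ring
        _ ≤ A * (L / 2 ^ (k + 1 + 22)) ^ (k + 1) * Q := by gcongr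
        _ = A * ((16 * ((k : ℝ) + 2) * L) ^ k * L) := by rw [← e1]; ring
        _ ≤ A * ((s * ((k : ℝ) + 3) ^ 4) ^ k * (cL * ∏ j, V j)) := by gcongr
        _ = ((((k + 2)! : ℕ) : ℝ) * ((k ! : ℕ) : ℝ) * 2 ^ (k + 1) * ((k : ℝ) + 3) ^ (4 * k) * cL) *
              (s ^ k * ∏ j, V j) := by rw [hA, hfac2, mul_pow, ← pow_mul]; ring
        _ ≤ ((16 * ((k : ℝ) + 2)) ^ k * 2 ^ ((k + 23) * k) * 2 ^ (k + 23) * 2 ^ (k + 24)) *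
              (s ^ k * ∏ j, V j) := mul_le_mul_of_nonneg_right hneed (by positivity)
        _ = (2 ^ (k + 24) * s ^ k) * ((∏ j, V j) * Q) := by rw [hQ]; ring
    have hmain := le_of_mul_le_mul_right key (by positivity)
    calc A * ∏ j, (D j : ℝ) ≤ 2 ^ (k + 24) * s ^ k := hmain
      _ ≤ 2 ^ (k + 24) * X * s ^ k := mul_le_mul_of_nonneg_right h24 hsk.le
      _ < xf * s ^ k := mul_lt_mul_of_pos_right hxf' hsk
      _ = s ^ k * xf := mul_comm _ _

/-- **Exit B, `d₀ = 0`, capped letters**: `(n+1)!·n!·2ⁿ·D₀·∏ Dⱼ < (S₀+1)ⁿ·(2X_f+1)` from the same facts plus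
`D₀ ≤ X·L/2` and the numeric side condition
`hN0 : (n+1)!n!2^{n−1}(n+2)^{4n}·c_L ≤ (16(n+1))ⁿ·2^{(n+22)n}·2^{n+23}`. [cite: Nesterenko2003, §5.2 Lemma 5.4] -/
theorem exitB_zero_capped {n : ℕ} (hn : 1 ≤ n) {V : Fin n → ℝ} (hV1 : ∀ j, 1 ≤ V j)
    {D : Fin n → ℕ} {ρ L X cL : ℝ} {S₀ Xf D₀ : ℕ}
    (hDρ : ∀ j, (D j : ℝ) ≤ ρ / V j + 1) (hρ1 : 1 ≤ ρ) (hρ : ρ < L / 2 ^ (n + 23)) (hL : 0 < L)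
    (hX1 : 1 ≤ X) (hD₀half : (D₀ : ℝ) ≤ X * L / 2)
    (hs : (16 : ℝ) * (n + 1) * L ≤ ((S₀ : ℝ) + 1) * ((n : ℝ) + 2) ^ 4)
    (hxf : (2 : ℝ) ^ (n + 23) * X < 2 * (Xf : ℝ) + 1) (hΩL : L ≤ cL * ∏ j, V j)
    (hN0 : (((n + 1)! : ℕ) : ℝ) * ((n ! : ℕ) : ℝ) * 2 ^ (n - 1) * ((n : ℝ) + 2) ^ (4 * n) * cL ≤
      (16 * ((n : ℝ) + 1)) ^ n * 2 ^ ((n + 22) * n) * 2 ^ (n + 23)) :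
    (n + 1)! * n ! * 2 ^ n * D₀ * ∏ j, D j < (S₀ + 1) ^ n * (2 * Xf + 1) := by
  obtain ⟨k, hk⟩ : ∃ k, n = k + 1 := ⟨n - 1, (Nat.sub_add_cancel hn).symm⟩
  subst hk
  simp only [Nat.add_sub_cancel] at hN0
  have hs0 : (0 : ℝ) < (S₀ : ℝ) + 1 := by positivity
  set s : ℝ := (S₀ : ℝ) + 1 with hsdef
  set xf : ℝ := 2 * (Xf : ℝ) + 1 with hxfdef
  have hs' : 16 * ((k : ℝ) + 2) * L ≤ s * ((k : ℝ) + 3) ^ 4 := by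
    have := hs; push_cast at this; rw [hsdef]; nlinarith
  have hbase : 0 ≤ 16 * ((k : ℝ) + 2) * L := by positivity
  have hxf' : (2 : ℝ) ^ (k + 24) * X < xf := by
    simpa [show k + 1 + 23 = k + 24 by ring] using hxf
  suffices hreal : (((k + 1 + 1)! : ℕ) : ℝ) * (((k + 1)! : ℕ) : ℝ) * 2 ^ (k + 1) * (D₀ : ℝ) *
      ∏ j, (D j : ℝ) < s ^ (k + 1) * xf by
    rw [hsdef, hxfdef] at hreal
    exact_mod_cast hreal
  obtain ⟨j₀, -, hj₀⟩ := Finset.exists_max_image (univ : Finset (Fin (k + 1))) V ⟨0, mem_univ _⟩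
  have hprod0 : 0 ≤ ∏ j, (D j : ℝ) := prod_nonneg fun j _ => by positivity
  have hD₀0 : (0 : ℝ) ≤ D₀ := by positivity
  have hsk : 0 < s ^ (k + 1) := by positivity
  have hX0 : (0 : ℝ) < X := by linarith
  by_cases hlt : ρ < V j₀
  · -- heavy case (verbatim the generic argument, master numeric `numB0i`)
    have hprod := prod_D_le_of_lt_of hV1 hDρ hρ1 hρ hL hlt
    simp only [Nat.add_sub_cancel] at hprod
    have hnum : (((k + 2)! * (k + 1)! * 2 ^ k * (k + 3) ^ (4 * (k + 1)) : ℕ) : ℝ) ≤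
        (((16 * (k + 2)) ^ (k + 1) * 2 ^ ((k + 22) * k) * 2 ^ (k + 24) : ℕ) : ℝ) := by
      exact_mod_cast numB0i k
    push_cast at hnum
    set Q : ℝ := (16 * ((k : ℝ) + 2)) ^ (k + 1) * 2 ^ ((k + 22) * k) with hQ
    have hQ0 : 0 < Q := by positivity
    have e1 : L * (L / 2 ^ (k + 1 + 21)) ^ k * Q = (16 * ((k : ℝ) + 2) * L) ^ (k + 1) := by
      rw [hQ, show k + 1 + 21 = k + 22 by ring]
      simp only [mul_pow, div_pow]
      rw [← pow_mul]
      field_simp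
      ring
    have hpow : (16 * ((k : ℝ) + 2) * L) ^ (k + 1) ≤ (s * ((k : ℝ) + 3) ^ 4) ^ (k + 1) :=
      pow_le_pow_left₀ hbase hs' _
    have key : (((k + 1 + 1)! : ℕ) : ℝ) * (((k + 1)! : ℕ) : ℝ) * 2 ^ (k + 1) * (D₀ : ℝ) *
          (∏ j, (D j : ℝ)) * Q ≤ (2 ^ (k + 24) * X * s ^ (k + 1)) * Q := by
      calc (((k + 1 + 1)! : ℕ) : ℝ) * (((k + 1)! : ℕ) : ℝ) * 2 ^ (k + 1) * (D₀ : ℝ) * (∏ j, (D j : ℝ)) * Q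
          ≤ (((k + 1 + 1)! : ℕ) : ℝ) * (((k + 1)! : ℕ) : ℝ) * 2 ^ (k + 1) * (X * L / 2) *
              (L / 2 ^ (k + 1 + 21)) ^ k * Q := by gcongr
        _ = (((k + 1 + 1)! : ℕ) : ℝ) * (((k + 1)! : ℕ) : ℝ) * 2 ^ k * X *
              (L * (L / 2 ^ (k + 1 + 21)) ^ k * Q) := by rw [pow_succ]; ring
        _ ≤ (((k + 1 + 1)! : ℕ) : ℝ) * (((k + 1)! : ℕ) : ℝ) * 2 ^ k * X *
              (s * ((k : ℝ) + 3) ^ 4) ^ (k + 1) := by rw [e1]; gcongr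
        _ = ((((k + 2)! : ℕ) : ℝ) * (((k + 1)! : ℕ) : ℝ) * 2 ^ k * ((k : ℝ) + 3) ^ (4 * (k + 1))) *
              X * s ^ (k + 1) := by
            rw [mul_pow, ← pow_mul, show k + 1 + 1 = k + 2 by ring]; ring
        _ ≤ ((16 * ((k : ℝ) + 2)) ^ (k + 1) * 2 ^ ((k + 22) * k) * 2 ^ (k + 24)) * X * s ^ (k + 1) := by
            gcongr
        _ = (2 ^ (k + 24) * X * s ^ (k + 1)) * Q := by rw [hQ]; ring
    have hmain := le_of_mul_le_mul_right key hQ0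
    calc (((k + 1 + 1)! : ℕ) : ℝ) * (((k + 1)! : ℕ) : ℝ) * 2 ^ (k + 1) * (D₀ : ℝ) * ∏ j, (D j : ℝ)
        ≤ 2 ^ (k + 24) * X * s ^ (k + 1) := hmain
      _ < xf * s ^ (k + 1) := mul_lt_mul_of_pos_right hxf' hsk
      _ = s ^ (k + 1) * xf := mul_comm _ _
  · -- light case: `Ω ∏ D ≤ (L/2^{k+23})^{k+1}`, `D₀ ≤ XL/2`, `L ≤ c_L·Ω`
    have hle : ∀ j, V j ≤ ρ := fun j => (hj₀ j (mem_univ j)).trans (not_lt.mp hlt)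
    have hprod := prod_mul_prod_D_le_of hV1 hDρ hρ1 hρ hL hle
    have hΩ : 0 < ∏ j, V j := prod_pos fun j _ => by linarith [hV1 j]
    have hneed : (((k + 2)! : ℕ) : ℝ) * (((k + 1)! : ℕ) : ℝ) * 2 ^ k * ((k : ℝ) + 3) ^ (4 * (k + 1)) * cL ≤
        (16 * ((k : ℝ) + 2)) ^ (k + 1) * 2 ^ ((k + 23) * (k + 1)) * 2 ^ (k + 24) := by
      have h := hN0
      simp only [show k + 1 + 1 = k + 2 by ring, show k + 1 + 22 = k + 23 by ring,
        show k + 1 + 23 = k + 24 by ring] at h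
      push_cast at h
      have e3 : ((k : ℝ) + 1 + 2) = (k : ℝ) + 3 := by ring
      have e4 : ((k : ℝ) + 1 + 1) = (k : ℝ) + 2 := by ring
      rw [e3, e4] at h
      exact h
    set Q : ℝ := (16 * ((k : ℝ) + 2)) ^ (k + 1) * 2 ^ ((k + 23) * (k + 1)) with hQ
    have hQ0 : 0 < Q := by positivity
    have e1 : (L / 2 ^ (k + 1 + 22)) ^ (k + 1) * Q = (16 * ((k : ℝ) + 2) * L) ^ (k + 1) := by
      rw [hQ, show k + 1 + 22 = k + 23 by ring, div_pow, ← pow_mul, mul_pow]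
      field_simp
      rw [mul_pow, mul_pow]; ring
    have hpow : (16 * ((k : ℝ) + 2) * L) ^ (k + 1) ≤ (s * ((k : ℝ) + 3) ^ 4) ^ (k + 1) :=
      pow_le_pow_left₀ hbase hs' _
    set A : ℝ := (((k + 1 + 1)! : ℕ) : ℝ) * (((k + 1)! : ℕ) : ℝ) * 2 ^ (k + 1) with hA
    have hA0 : 0 ≤ A := by positivity
    have hfac2 : (((k + 1 + 1)! : ℕ) : ℝ) = (((k + 2)! : ℕ) : ℝ) := by rw [show k + 1 + 1 = k + 2 by ring]
    have hXL0 : 0 ≤ X * L / 2 := by positivity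
    have hcLΩ : 0 ≤ cL * ∏ j, V j := hL.le.trans hΩL
    -- step 1: `D₀ · (Ω ∏D) ≤ (XL/2) · (L/2^{k+23})^{k+1}`
    have step1 : (D₀ : ℝ) * ((∏ j, V j) * ∏ j, (D j : ℝ)) ≤ (X * L / 2) * (L / 2 ^ (k + 1 + 22)) ^ (k + 1) :=
      mul_le_mul hD₀half hprod (mul_nonneg hΩ.le hprod0) hXL0
    have key : A * (D₀ : ℝ) * (∏ j, (D j : ℝ)) * ((∏ j, V j) * Q) ≤
        (2 ^ (k + 24) * X * s ^ (k + 1)) * ((∏ j, V j) * Q) := by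
      calc A * (D₀ : ℝ) * (∏ j, (D j : ℝ)) * ((∏ j, V j) * Q)
          = A * ((D₀ : ℝ) * ((∏ j, V j) * ∏ j, (D j : ℝ))) * Q := by ring
        _ ≤ A * ((X * L / 2) * (L / 2 ^ (k + 1 + 22)) ^ (k + 1)) * Q :=
            mul_le_mul_of_nonneg_right (mul_le_mul_of_nonneg_left step1 hA0) hQ0.le
        _ = A * (X / 2) * L * ((L / 2 ^ (k + 1 + 22)) ^ (k + 1) * Q) := by ring
        _ = A * (X / 2) * L * (16 * ((k : ℝ) + 2) * L) ^ (k + 1) := by rw [e1]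
        _ ≤ A * (X / 2) * (cL * ∏ j, V j) * (s * ((k : ℝ) + 3) ^ 4) ^ (k + 1) :=
            mul_le_mul (mul_le_mul_of_nonneg_left hΩL (by positivity)) hpow (by positivity)
              (mul_nonneg (by positivity) hcLΩ)
        _ = ((((k + 2)! : ℕ) : ℝ) * (((k + 1)! : ℕ) : ℝ) * 2 ^ k * ((k : ℝ) + 3) ^ (4 * (k + 1)) * cL) *
              (X * s ^ (k + 1) * ∏ j, V j) := by
            rw [hA, hfac2, mul_pow, ← pow_mul, pow_succ]; ring
        _ ≤ ((16 * ((k : ℝ) + 2)) ^ (k + 1) * 2 ^ ((k + 23) * (k + 1)) * 2 ^ (k + 24)) *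
              (X * s ^ (k + 1) * ∏ j, V j) := mul_le_mul_of_nonneg_right hneed (by positivity)
        _ = (2 ^ (k + 24) * X * s ^ (k + 1)) * ((∏ j, V j) * Q) := by rw [hQ]; ring
    have hmain := le_of_mul_le_mul_right key (by positivity)
    calc A * (D₀ : ℝ) * ∏ j, (D j : ℝ) ≤ 2 ^ (k + 24) * X * s ^ (k + 1) := hmain
      _ < xf * s ^ (k + 1) := mul_lt_mul_of_pos_right hxf' hsk
      _ = s ^ (k + 1) * xf := mul_comm _ _

/-- **Exit B on the capped letters** — hypothesis `hB` of `RecordAssembly.recordOdd_of_ineqs`-shape (and of p4's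
`RecordArchW` clause (B) assembly): from the two scalar lines via `exitB_of_bounds`. [cite: Nesterenko2003, §5.2 Lemma 5.4] -/
theorem exitB_capped {n : ℕ} (hn : 1 ≤ n) {V : Fin n → ℝ} (hV1 : ∀ j, 1 ≤ V j)
    {D : Fin n → ℕ} {ρ L X cL : ℝ} {S₀ Xf D₀ : ℕ}
    (hDρ : ∀ j, (D j : ℝ) ≤ ρ / V j + 1) (hρ1 : 1 ≤ ρ) (hρ : ρ < L / 2 ^ (n + 23)) (hL : 0 < L)
    (hX1 : 1 ≤ X) (hD₀1 : 1 ≤ D₀) (hD₀half : (D₀ : ℝ) ≤ X * L / 2)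
    (hs : (16 : ℝ) * (n + 1) * L ≤ ((S₀ : ℝ) + 1) * ((n : ℝ) + 2) ^ 4)
    (hxf : (2 : ℝ) ^ (n + 23) * X < 2 * (Xf : ℝ) + 1) (hΩL : L ≤ cL * ∏ j, V j)
    (hN0 : (((n + 1)! : ℕ) : ℝ) * ((n ! : ℕ) : ℝ) * 2 ^ (n - 1) * ((n : ℝ) + 2) ^ (4 * n) * cL ≤
      (16 * ((n : ℝ) + 1)) ^ n * 2 ^ ((n + 22) * n) * 2 ^ (n + 23))
    (hN1 : (((n + 1)! : ℕ) : ℝ) * (((n - 1)! : ℕ) : ℝ) * 2 ^ n * ((n : ℝ) + 2) ^ (4 * (n - 1)) * cL ≤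
      (16 * ((n : ℝ) + 1)) ^ (n - 1) * 2 ^ ((n + 22) * (n - 1)) * 2 ^ (n + 22) * 2 ^ (n + 23)) :
    ∀ d₀ : ℕ, d₀ ≤ 1 →
      (n + 1)! * 2 ^ n * D₀ * ∏ j, D j <
        Nat.choose (S₀ + (n - d₀)) (n - d₀) * (2 * Xf + 1) * (d₀ ! * D₀ ^ d₀) :=
  exitB_of_bounds hD₀1 le_rfl
    (exitB_zero_capped hn hV1 hDρ hρ1 hρ hL hX1 hD₀half hs hxf hΩL hN0)
    (exitB_one_capped hn hV1 hDρ hρ1 hρ hL hX1 hs hxf hΩL hN1)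

end RecordExitsNumeric

end Summit.ABC.StewartYu
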